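import Summits.BirchSwinnertonDyer.BirchSwinnertonDyer.Theorems.ManinLocalTwoThreeTwoShiftEqualiserHolds
import Summits.BirchSwinnertonDyer.BirchSwinnertonDyer.Theorems.ManinLocalTwoThreeTwoAdicDegeneracyUnitTwist
import Summits.BirchSwinnertonDyer.Rank1Residual.ManinAdditive.NineShiftConjDefect
import HarnessLib

/-!
# The 2-ADIC TWIN, VII: G₈ ⟹ (CD₈) ⟹ the odd ratio-8 degeneracy plus index ⟹ the 2-adic polar witness and `2 ∤ c(W)` on the
# squarefull `4 ∣ N` cell modulo Kato's fact at `W` — the `p = 2` twin of es's `NineShiftConjDefect` / ORBIT CRITERION edges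
# (route `ManinLocalTwoThree`, cell bsd-f2-manin; crux C2 `ManinOddAtFour` stmt-BirchSwinnertonDyer-22967; prover seat p3 gen 11)

With G₈ `TwoShift.eightShiftInvariantIsDiamond_holds` (file VI) the `p = 2` structure theorem is consumed toward C2 exactly as
E-es-94♯ is consumed toward C3 (`NineShiftEqualiser.conjDefectLawNine_of_nineShiftInvariantIsDiamond`, `DegeneracyOrbit.degeneracyClass_of_conjDefect`):
* §1 the PLUS-PERIOD CHARACTER MOD 2 `j̄_f : Γ₀(N) → 𝔽₂` (`plusCharMod2`, from the tree's `NineShiftEqualiser.plusCoord`): additive, and NOT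
  a diamond class when `[Λ_f⁺ : Λ₁(f)⁺]` is odd (`PlusIndexPrimeTo 2 f`);
* §2 **(CD₈) UNCONDITIONALLY**: `conjDefectOdd_eight` — every rational newform `f` on `Γ₀(N)` (ANY `N ≥ 1`) with odd plus index has a
  conjugation defect `D(γ) = {∞, δ∞} − {∞, γ∞}` of ratio `8` (`δ = diag(8,1) γ diag(8,1)⁻¹`) with ODD plus coordinate (G₈ forces
  `j̄_f ∉ K₈`);
* §3 **ORBIT CRITERION at `p = 2`** (`degeneracyPlusIndex_of_conjDefectOdd`, port of THEOREM O without the class filter): an odd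
  conjugation defect of ratio `t` moves, along the lower-unipotent orbit of the cusp `γ·0 = b/d` and by DIRICHLET, to a degeneracy loop
  `{∞, t b₀/p} − {∞, b₀/p}` at a prime `p ∤ tN`, so every `x ∈ Λ_f` has an ODD multiple of `x + x̄` among the plus parts of
  `closure (degeneracyLoops f t)`;
* §4 BY-NAME C2 EDGES (no cell law, no E-es-68₈): **`twoAdicPolarWitness_of_plusIndexPrimeTo_squarefull`** (`4 ∣ N` squarefull,
  `PlusIndexPrimeTo 2 D.f` ⟹ `TwoAdicPolarWitness W W D.f`, via the seat's `twoAdicPolarWitness_of_degeneracyEightPlusIndex`) and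
  **`not_two_dvd_maninConstant_of_eightShift_squarefull`** (`2 ∤ D.c` modulo `KatoFactTwoAt W D.f`; composite-squarefull variant
  discharging the plus index by an odd `q² ∣ N`).
HONEST FRAMING: these C2 edges are ALSO given by the unconditional E-es-66₂ (`twoAdicWitnessOfPlusIndexOdd_holds`, an's q-tower); the new
content is that the f-free structure theorem G₈ is a second, independent parent.  Nothing about BSD, Manin's conjecture or C2 is proved
(Kato's fact at `W` and the plus index remain hypotheses).  [cite: Kato2004Asterisque, Thm. 12.5 (1) (p. 221) (shape: the hypothesis
`KatoFactTwoAt`)] Reference: HOME/MEMO-es.md §36–§37.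
-/

set_option autoImplicit false
set_option linter.dupNamespace false

open scoped Classical MatrixGroups ModularForm ComplexConjugate

open CongruenceSubgroup Complex Literature.NumberTheory.EllipticCurves
  Literature.NumberTheory.EllipticCurves.ModularForms
open Summit.BirchSwinnertonDyer.Rank1Residual.ManinAdditive.KatoCurve
open Summit.BirchSwinnertonDyer.Rank1Residual.ManinAdditive.Gamma1Lattice
open Summit.BirchSwinnertonDyer.Rank1Residual.ManinAdditive.DegeneracyOrbit
open Summit.BirchSwinnertonDyer.Rank1Residual.ManinAdditive.NineShiftEqualiser (slOf g0Of g0Of_congr plusCoord plusCoord_spec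
  plusCoord_mul conjDefect_add_conj)

noncomputable section

namespace Summit.BirchSwinnertonDyer.BirchSwinnertonDyer.Theorems.ManinLocalTwoThree

namespace TwoShift

variable {N : ℕ} (f : CuspForm (Gamma0 N) 2)

/-! ### §1. The plus-period character mod 2 -/

/-- THE PLUS CHARACTER MOD 2 `j̄_f : Γ₀(N) → ℤ/2`, `γ ↦ k(γ) mod 2` where `{∞, γ∞}_f + conj = k(γ)·Ω⁺_f`. -/
def plusCharMod2 (hre : realPeriods f = AddSubgroup.zmultiples (plusPeriod f / 2)) : Gamma0 N → ZMod 2 :=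
  fun γ => ((plusCoord f hre γ : ℤ) : ZMod 2)

/-- `j̄_f` is additive. [folklore] -/
theorem isAdd_plusCharMod2 [NeZero N] (hre : realPeriods f = AddSubgroup.zmultiples (plusPeriod f / 2))
    (hΩ : plusPeriod f ≠ 0) : IsAdd (plusCharMod2 f hre) := by
  intro γ δ
  simp only [plusCharMod2, plusCoord_mul f hre hΩ, Int.cast_add]

/-- If `[Λ_f⁺ : Λ₁(f)⁺]` is odd (`PlusIndexPrimeTo 2 f`), then `j̄_f` is NOT a diamond class: some `Γ₁(N)`-period has odd plus
coordinate (the seat's prime-generic `exists_mem_plus_not_dvd`). [folklore] -/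
theorem not_isDiamond_plusCharMod2 [NeZero N] (hre : realPeriods f = AddSubgroup.zmultiples (plusPeriod f / 2))
    (hf : IsNewform0 f) (hQ : coeffField f = ⊥) (hd : PlusIndexPrimeTo 2 f) : ¬ IsDiamond (plusCharMod2 f hre) := by
  intro hdia
  have hΩ : plusPeriod f ≠ 0 := (IsNewform0.plusPeriod_pos_holds hf hQ).ne'
  have hΩC : (plusPeriod f : ℂ) ≠ 0 := by exact_mod_cast hΩ
  have hS : (Set.range fun γ : Gamma1 N ↦ cuspSymbol f ⟨(γ : SL(2, ℤ)), Gamma1_in_Gamma0 N γ.2⟩) ⊆ periodLattice f := by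
    rintro _ ⟨γ, rfl⟩
    exact cuspSymbol_mem_periodLattice f _
  obtain ⟨z, ⟨γ, rfl⟩, j, hj, hj2⟩ := exists_mem_plus_not_dvd hf hQ (p := 2) hS hd
  have h0 : plusCharMod2 f hre ⟨(γ : SL(2, ℤ)), Gamma1_in_Gamma0 N γ.2⟩ = 0 := hdia γ.1 γ.2
  have hk := plusCoord_spec f hre ⟨(γ : SL(2, ℤ)), Gamma1_in_Gamma0 N γ.2⟩
  obtain ⟨m, hm⟩ := (ZMod.intCast_zmod_eq_zero_iff_dvd _ 2).mp h0
  have e : ((j : ℤ) : ℂ) = ((plusCoord f hre ⟨(γ : SL(2, ℤ)), Gamma1_in_Gamma0 N γ.2⟩ : ℤ) : ℂ) :=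
    mul_right_cancel₀ hΩC (hj.symm.trans hk)
  have hjk : j = plusCoord f hre ⟨(γ : SL(2, ℤ)), Gamma1_in_Gamma0 N γ.2⟩ := by exact_mod_cast e
  exact hj2 ⟨m, by rw [hjk, hm]⟩

/-! ### §2. (CD₈): an ODD conjugation defect of ratio 8, unconditionally from G₈ -/

/-- **Odd conjugation defect of ratio `t`**: some `γ = (a b; tc d) ∈ Γ₀(tN)` whose defect `D(γ) = {∞, δ∞}_f − {∞, γ∞}_f`
(`δ = (a tb; c d)`) has ODD plus coordinate. -/
def ConjDefectOdd (t : ℕ) : Prop :=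
  ∃ (a b c d : ℤ) (hdet : a * d - b * (t * c) = 1) (hc : (N : ℤ) ∣ c) (k : ℤ), ¬ 2 ∣ k ∧
    conjDefect f t a b c d hdet hc + conj (conjDefect f t a b c d hdet hc) = (k : ℂ) * (plusPeriod f : ℂ)

/-- If `j̄_f` is NOT 8-shift invariant, `f` has an odd conjugation defect of ratio `8`. [folklore] -/
theorem conjDefectOdd_of_not_isEightShiftInvariant (hre : realPeriods f = AddSubgroup.zmultiples (plusPeriod f / 2))
    (h : ¬ IsEightShiftInvariant (plusCharMod2 f hre)) : ConjDefectOdd f 8 := by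
  unfold IsEightShiftInvariant at h
  push Not at h
  obtain ⟨a, b, c, d, hdet, hc, hne⟩ := h
  have hdet8 : a * d - b * ((8 : ℕ) * c) = 1 := by push_cast; linear_combination hdet
  refine ⟨a, b, c, d, hdet8, hc, plusCoord f hre (g0Of a ((8 : ℕ) * b) c d (by linear_combination hdet8) hc)
      - plusCoord f hre (g0Of a b ((8 : ℕ) * c) d hdet8 (Dvd.dvd.mul_left hc _)), ?_, conjDefect_add_conj f hre 8 a b c d hdet8 hc⟩
  intro h2
  apply hne
  have e1 : (g0Of (M := N) a (8 * b) c d (by linear_combination hdet) hc) =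
      g0Of a ((8 : ℕ) * b) c d (by linear_combination hdet8) hc := g0Of_congr rfl (by push_cast; ring) rfl rfl _ _ _ _
  have e2 : (g0Of (M := N) a b (8 * c) d hdet (Dvd.dvd.mul_left hc 8)) =
      g0Of a b ((8 : ℕ) * c) d hdet8 (Dvd.dvd.mul_left hc _) := g0Of_congr rfl rfl (by push_cast; ring) rfl _ _ _ _
  rw [e1, e2]
  simp only [plusCharMod2]
  rw [← sub_eq_zero, ← Int.cast_sub]
  exact (ZMod.intCast_zmod_eq_zero_iff_dvd _ 2).mpr h2

/-- **(CD₈) — UNCONDITIONAL (from G₈):** every rational newform with odd plus index has an odd conjugation defect of ratio `8`, at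
EVERY level `N ≥ 1`. [new: the `p = 2` twin of es's (CD₉), unconditional] -/
theorem conjDefectOdd_eight [NeZero N] (hf : IsNewform0 f) (hQ : coeffField f = ⊥) (hd : PlusIndexPrimeTo 2 f) :
    ConjDefectOdd f 8 := by
  have hΩ : plusPeriod f ≠ 0 := (IsNewform0.plusPeriod_pos_holds hf hQ).ne'
  obtain ⟨hre, -⟩ := realPeriods_eq_zmultiples_of_plusPeriod_ne_zero f hΩ
  by_contra hno
  have hinv : IsEightShiftInvariant (plusCharMod2 f hre) := by
    by_contra hni
    exact hno (conjDefectOdd_of_not_isEightShiftInvariant f hre hni)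
  exact not_isDiamond_plusCharMod2 f hre hf hQ hd
    (eightShiftInvariantIsDiamond_holds N (Nat.pos_of_ne_zero (NeZero.ne N)) (plusCharMod2 f hre)
      (isAdd_plusCharMod2 f hre hΩ) hinv)

/-! ### §3. The ORBIT CRITERION at `p = 2`: odd defect ⟹ odd ratio-`t` degeneracy plus index -/

/-- **ORBIT CRITERION (THEOREM O at `p = 2`; PROVED).**  For a rational newform `f` on `Γ₀(N)` and a ratio `t` with `tN > 1`: an
odd conjugation defect of ratio `t` makes every `x ∈ Λ_f` have an ODD multiple of `x + x̄` among the plus parts of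
`closure (degeneracyLoops f t)`.  Dirichlet supplies a prime on the unipotent orbit of the cusp `γ·0 = b/d`. [folklore] -/
theorem degeneracyPlusIndex_of_conjDefectOdd [NeZero N] (hf : IsNewform0 f) (hQ : coeffField f = ⊥) {t : ℕ}
    (htN : 1 < t * N) (h : ConjDefectOdd f t) :
    ∀ x ∈ periodLattice f, ∃ y ∈ AddSubgroup.closure (degeneracyLoops f t), ∃ k : ℕ, ¬ 2 ∣ k ∧
      (k : ℂ) * (x + conj x) = y + conj y := by
  have hΩ : plusPeriod f ≠ 0 := (IsNewform0.plusPeriod_pos_holds hf hQ).ne'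
  have hΩC : (plusPeriod f : ℂ) ≠ 0 := by exact_mod_cast hΩ
  obtain ⟨hre, -⟩ := realPeriods_eq_zmultiples_of_plusPeriod_ne_zero f hΩ
  obtain ⟨a, b, c, d, hdet, hc, k, hk2, hk⟩ := h
  set D := conjDefect f t a b c d hdet hc with hDdef
  have ht0 : t ≠ 0 := by rintro rfl; simp at htN
  have htpos : 0 < t := Nat.pos_of_ne_zero ht0
  have hNpos : 0 < N := Nat.pos_of_ne_zero (NeZero.ne N)
  -- `d ≠ 0` (else `tc = ±1` with `tN ∣ tc`, `tN > 1`)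
  obtain ⟨c₀, hc₀⟩ := id hc
  have hd0 : d ≠ 0 := by
    rintro rfl
    have h1 : ((t : ℤ) * N) ∣ 1 := ⟨-(b * c₀), by rw [hc₀] at hdet; linear_combination -hdet⟩
    have h2 : (t * N : ℕ) ∣ 1 := by exact_mod_cast Int.natCast_dvd_natCast.mp (by exact_mod_cast h1)
    exact absurd (Nat.eq_one_of_dvd_one h2) (by omega)
  -- `b ≠ 0` (else `D = 0`)
  have hb0 : b ≠ 0 := by
    rintro rfl
    have hD0 : D = 0 := by
      rw [hDdef, ← loop_base_eq_conjDefect f t a 0 c d hdet hc hd0]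
      simp
    rw [hD0, map_zero, add_zero] at hk
    have hkC : (k : ℂ) = 0 := by
      rcases mul_eq_zero.mp hk.symm with h | h
      · exact h
      · exact absurd h hΩC
    have hk0 : k = 0 := by exact_mod_cast hkC
    exact hk2 (hk0 ▸ dvd_zero 2)
  -- coprimality of `d` with `t`, `N`, `b`
  have hcop_t : IsCoprime d (t : ℤ) := ⟨a, -(b * c), by linear_combination hdet⟩
  have hcop_N : IsCoprime d (N : ℤ) := ⟨a, -(b * t * c₀), by rw [hc₀] at hdet; linear_combination hdet⟩
  have hcop_b : IsCoprime d b := ⟨a, -(t * c), by linear_combination hdet⟩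
  -- `β = |b|`, `ε = sign b`
  set ε : ℤ := Int.sign b with hεdef
  set β : ℤ := (b.natAbs : ℤ) with hβdef
  have hεβ : ε * β = b := Int.sign_mul_natAbs b
  have hε : ε = 1 ∨ ε = -1 := by
    rcases lt_or_gt_of_ne hb0 with h | h
    · exact Or.inr (Int.sign_eq_neg_one_of_neg h)
    · exact Or.inl (Int.sign_eq_one_of_pos h)
  have hεsq : ε * ε = 1 := by rcases hε with h | h <;> rw [h] <;> norm_num
  have hbε : b * ε = β := by rw [← hεβ]; linear_combination β * hεsq
  -- the modulus `M = t N |b|` and Dirichlet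
  set M : ℕ := t * N * b.natAbs with hMdef
  have hM0 : M ≠ 0 := by
    have : b.natAbs ≠ 0 := Int.natAbs_ne_zero.mpr hb0
    positivity
  have hMZ : (M : ℤ) = (t : ℤ) * N * β := by simp only [hMdef, hβdef, Nat.cast_mul]
  have hcop_β : IsCoprime d β := by
    have h := hcop_b
    rw [← hεβ] at h
    exact h.of_mul_right_right
  have hcop_M : IsCoprime d (M : ℤ) := by
    rw [hMZ]
    exact (hcop_t.mul_right hcop_N).mul_right hcop_β
  obtain ⟨p, hpgt, hpP, hpmod⟩ :=
    Nat.forall_exists_prime_gt_and_zmodEq (t * N + b.natAbs + 3) hM0 hcop_M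
  have hp0Q : (p : ℚ) ≠ 0 := by exact_mod_cast hpP.ne_zero
  have hp0 : (p : ℤ) ≠ 0 := by exact_mod_cast hpP.ne_zero
  obtain ⟨q, hq⟩ := hpmod.dvd
  -- `hq : d - p = M * q`
  set kk : ℤ := -(ε * q) with hkkdef
  have hkey : d + (t : ℤ) * N * b * kk = p := by
    have hp' : (p : ℤ) = d - (M : ℤ) * q := by linarith [hq]
    rw [hp', hkkdef, hMZ]
    linear_combination (-(t : ℤ) * N * q) * hbε
  have hkeyQ : (d : ℚ) + t * N * b * kk = p := by exact_mod_cast hkey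
  have hden : (d : ℚ) + t * N * b * kk ≠ 0 := by rw [hkeyQ]; exact hp0Q
  -- the loop on the orbit equals `D`
  have hloop := loop_shift_eq_conjDefect f t a b c d hdet hc hd0 kk hden
  rw [hkeyQ] at hloop
  have hptN : ¬ p ∣ t * N := by
    intro h'
    have : p ≤ t * N := Nat.le_of_dvd (by positivity) h'
    omega
  -- the representative `b₀ ∈ [0, p)` of `b`
  have hb₀nn : 0 ≤ b % p := Int.emod_nonneg _ hp0
  set b₀ : ℕ := (b % p).toNat with hb₀def
  have hb₀Z : (b₀ : ℤ) = b % p := Int.toNat_of_nonneg hb₀nn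
  have hb₀lt : (b₀ : ℤ) < p := by rw [hb₀Z]; exact Int.emod_lt_of_pos _ (by exact_mod_cast hpP.pos)
  have hpb₀ : ¬ p ∣ b₀ := by
    intro h'
    have hb00 : b₀ = 0 := Nat.eq_zero_of_dvd_of_lt h' (by exact_mod_cast hb₀lt)
    have hpb : (p : ℤ) ∣ b := Int.dvd_of_emod_eq_zero (by rw [← hb₀Z, hb00]; rfl)
    have hpd : (p : ℤ) ∣ d := by
      have : d = p - (t : ℤ) * N * b * kk := by linarith [hkey]
      rw [this]
      exact dvd_sub (dvd_refl _) (Dvd.dvd.mul_right (Dvd.dvd.mul_left hpb _) kk)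
    have hu : IsUnit (p : ℤ) := hcop_b.isUnit_of_dvd' hpd hpb
    rcases Int.isUnit_iff.mp hu with h1 | h1
    · exact hpP.one_lt.ne' (by exact_mod_cast h1)
    · have : (0 : ℤ) ≤ p := by positivity
      omega
  -- the loop `{∞, t b₀/p} − {∞, b₀/p}` is `D`
  have hms1 : modularSymbol f ((b₀ : ℚ) / p) = modularSymbol f ((b : ℚ) / p) := by
    refine modularSymbol_eq_of_eq_add_int f (n := -(b / p)) ?_
    have e : ((b₀ : ℤ) : ℚ) = ((b % p : ℤ) : ℚ) := by exact_mod_cast hb₀Z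
    rw [Int.emod_def] at e
    push_cast at e ⊢
    rw [e]
    field_simp
    ring
  have hms2 : modularSymbol f (((t * b₀ : ℕ) : ℚ) / p) = modularSymbol f ((t : ℚ) * b / p) := by
    refine modularSymbol_eq_of_eq_add_int f (n := -(t * (b / p))) ?_
    have e : ((b₀ : ℤ) : ℚ) = ((b % p : ℤ) : ℚ) := by exact_mod_cast hb₀Z
    rw [Int.emod_def] at e
    push_cast at e ⊢
    rw [e]
    field_simp
    ring
  have hDloop : modularSymbol f (((t * b₀ : ℕ) : ℚ) / p) - modularSymbol f ((b₀ : ℚ) / p) = D := by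
    rw [hms1, hms2, hDdef, ← hloop, mul_div_assoc]
  have hDS : D ∈ degeneracyLoops f t := ⟨p, b₀, hpP, hptN, hpb₀, hDloop.symm⟩
  -- conclusion
  intro x hx
  obtain ⟨j, hj⟩ := exists_add_conj_eq_int_mul f hre hx
  refine ⟨((j * k : ℤ) : ℂ) * D, ?_, k.natAbs ^ 2, ?_, ?_⟩
  · rw [← zsmul_eq_mul]
    exact AddSubgroup.zsmul_mem _ (AddSubgroup.subset_closure hDS) _
  · intro h'
    exact hk2 (Int.natCast_dvd.mpr (Nat.prime_two.dvd_of_dvd_pow h'))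
  · have hk2' : ((k.natAbs ^ 2 : ℕ) : ℂ) = (k : ℂ) ^ 2 := by
      have h' : (((k.natAbs : ℤ) ^ 2 : ℤ) : ℂ) = ((k ^ 2 : ℤ) : ℂ) :=
        congrArg (fun z : ℤ => (z : ℂ)) (Int.natAbs_sq k)
      push_cast at h'
      rw [Nat.cast_pow]
      simpa using h'
    have hx' : x + starRingEnd ℂ x = (j : ℂ) * (plusPeriod f : ℂ) := hj
    rw [hk2', hx', map_mul, map_intCast, ← mul_add, hk]
    push_cast
    ring

/-- **the odd ratio-8 degeneracy plus index, UNCONDITIONALLY** (G₈ + (CD₈) + the orbit criterion), at every level `N ≥ 1`. [new] -/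
theorem degeneracyEightPlusIndex_of_plusIndexPrimeTo [NeZero N] (hf : IsNewform0 f) (hQ : coeffField f = ⊥)
    (hd : PlusIndexPrimeTo 2 f) :
    ∀ x ∈ periodLattice f, ∃ y ∈ AddSubgroup.closure (degeneracyLoops f 8), ∃ k : ℕ, ¬ 2 ∣ k ∧
      (k : ℂ) * (x + conj x) = y + conj y :=
  degeneracyPlusIndex_of_conjDefectOdd f hf hQ
    (by have := Nat.pos_of_ne_zero (NeZero.ne N); omega) (conjDefectOdd_eight f hf hQ hd)

end TwoShift

/-! ### §4. The C2 edges BY NAME (no cell law) -/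

open TwoShift WeierstrassCurve

/-- **The `2`-adic polar witness on the squarefull `4 ∣ N` cell from the plus index alone** (via G₈, no E-es-68₈):
`PlusIndexPrimeTo 2 D.f ⟹ TwoAdicPolarWitness W W D.f`. [new: second, f-free parent of E-es-66₂ on the squarefull cell] -/
theorem twoAdicPolarWitness_of_plusIndexPrimeTo_squarefull
    (W : WeierstrassCurve ℚ) [W.IsElliptic] {N : ℕ} [NeZero N] (D : ModularParametrizationData W N)
    (h4 : 2 ^ 2 ∣ N) (hsq : ∀ ℓ ∈ N.primeFactors, ℓ ^ 2 ∣ N) (hd : PlusIndexPrimeTo 2 D.f) :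
    TwoAdicPolarWitness W W D.f :=
  twoAdicPolarWitness_of_degeneracyEightPlusIndex W D h4 hsq
    (degeneracyEightPlusIndex_of_plusIndexPrimeTo D.f D.isNewformOf.1 D.isNewformOf.coeffField_eq_bot hd)

/-- **`2 ∤ c(W)` on the squarefull `4 ∣ N` cell, modulo ONLY Kato's fact at `W` and the odd plus index** (via G₈).
[cite: Kato2004Asterisque, Thm. 12.5 (1) (p. 221) (shape: the hypothesis `KatoFactTwoAt`)] -/
theorem not_two_dvd_maninConstant_of_eightShift_squarefull
    (W : WeierstrassCurve ℚ) [W.IsElliptic] [W.IsGloballyMinimal] {N : ℕ} [NeZero N]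
    (D : ModularParametrizationData W N) (hF : KatoFactTwoAt W D.f)
    (hopt : ∀ z ∈ D.L.lattice, ∃ w ∈ periodLattice D.f, z = D.c * w)
    (h4 : 2 ^ 2 ∣ N) (hsq : ∀ ℓ ∈ N.primeFactors, ℓ ^ 2 ∣ N) (hd : PlusIndexPrimeTo 2 D.f) : ¬ (2 : ℤ) ∣ D.c :=
  not_two_dvd_maninConstant_of_degeneracyEightPlusIndex_squarefull W D hF hopt h4 hsq
    (degeneracyEightPlusIndex_of_plusIndexPrimeTo D.f D.isNewformOf.1 D.isNewformOf.coeffField_eq_bot hd)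

/-- **Composite squarefull variant**: an odd prime `q` with `q² ∣ N` discharges the plus index (Hecke sieve `plusIndexPrimeTo_of_sq_dvd`),
so `2 ∤ c(W)` modulo ONLY `KatoFactTwoAt W D.f`. [cite: Kato2004Asterisque, Thm. 12.5 (1) (p. 221) (shape)] -/
theorem not_two_dvd_maninConstant_of_eightShift_squarefull' (W : WeierstrassCurve ℚ) [W.IsElliptic] [W.IsGloballyMinimal]
    {N : ℕ} [NeZero N] (D : ModularParametrizationData W N) (hF : KatoFactTwoAt W D.f)
    (hopt : ∀ z ∈ D.L.lattice, ∃ w ∈ periodLattice D.f, z = D.c * w)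
    (h4 : 2 ^ 2 ∣ N) (hsq : ∀ ℓ ∈ N.primeFactors, ℓ ^ 2 ∣ N) {q : ℕ} (hq : q.Prime) (hq2 : q ≠ 2) (hqN : q ^ 2 ∣ N) :
    ¬ (2 : ℤ) ∣ D.c :=
  not_two_dvd_maninConstant_of_eightShift_squarefull W D hF hopt h4 hsq
    (plusIndexPrimeTo_of_sq_dvd D.isNewformOf.1 hq hqN
      fun h ↦ hq2 ((Nat.prime_dvd_prime_iff_eq Nat.prime_two hq).mp h).symm)

end Summit.BirchSwinnertonDyer.BirchSwinnertonDyer.Theorems.ManinLocalTwoThree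

end
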